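import Mathlib.NumberTheory.ArithmeticFunction.VonMangoldt
import Mathlib.NumberTheory.PrimeCounting
import Mathlib.NumberTheory.SmoothNumbers
import Mathlib.Analysis.Convex.Basic
import Mathlib.MeasureTheory.Measure.Lebesgue.Basic
import Mathlib.MeasureTheory.Constructions.Pi
import Mathlib.LinearAlgebra.AffineSpace.AffineMap
import Mathlib.Data.Nat.Totient
import HarnessLib
import HarnessLib.Audit

/-!
# Linear equations in primes: the generalised Hardy–Littlewood conjecture (Green–Tao form)

Trunk T-SIEVE (`Literature/NumberTheory/Sieve`), notion `GeneralizedHardyLittlewood`, the second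
conjunct of the tier-2 summit `Parity := BatemanHorn ∧ GeneralizedHardyLittlewood` (D-0013;
`Summits/Parity/Statement.lean` imports this file).

We formalise §1 of B. Green, T. Tao, *Linear equations in primes*, Ann. of Math. 171 (2010):

* `Literature.AffLinForm d` — an affine-linear form `ψ = ψ̇ + ψ(0)` on `ℤ^d` (Def. 1.1), given by its
  integer coefficients `ψ̇(e_j)` and constant `ψ(0)`; a *system* is `Ψ : Fin t → AffLinForm d`;
  `AffLinForm.toAffineMap` is the bridge to Mathlib's `(Fin d → ℤ) →ᵃ[ℤ] ℤ` and
  `AffLinForm.realEval` the extension to `ℝ^d`;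
* `Literature.IsNondegenerateSystem Ψ` — Green–Tao's standing non-degeneracy hypotheses (Def. 1.1:
  every form non-constant, no two forms rational multiples of each other) and
  `Literature.IsFiniteComplexitySystem Ψ` (Def. 1.5 in the equivalent form "no two linear parts
  `ψ̇ᵢ, ψ̇ⱼ` are parallel");
* `Literature.affLinSize Ψ N = ‖Ψ‖_N` (eq. (1.1));
* `Literature.NumberTheory.Sieve.intVonMangoldt` (`Λ` on `ℤ`, zero on `n ≤ 0`), `Literature.localVonMangoldt q` (`Λ_{ℤ/qℤ}`,
  eq. (1.5)), `Literature.localFactor Ψ q = β_q` (eq. (1.6)), the ordered singular product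
  `Literature.singularProduct Ψ = ∏_p β_p` with partial products `Literature.NumberTheory.Sieve.singularProductPartial`
  (D-SIEVE-1 convention of this directory), and the archimedean factor
  `Literature.archFactor Ψ K = β_∞ = vol_d(K ∩ Ψ⁻¹(ℝ₊ᵗ))` (eq. (1.4));
* `Literature.vonMangoldtSum Ψ K N = ∑_{n ∈ K ∩ ℤ^d} ∏ᵢ Λ(ψᵢ(n))` (eq. (1.2)) and
  `Literature.primePointCount Ψ K N = #{n ∈ K ∩ ℤ^d : ψ₁(n), …, ψ_t(n) prime}`;
* **`Literature.NumberTheory.Sieve.GeneralizedHardyLittlewood`** — Conjecture 1.2 (all complexities, von Mangoldt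
  weights, error `o_{t,d,L}(N^d)`), and `Literature.NumberTheory.Sieve.GeneralizedHardyLittlewoodCount` — Conjecture 1.4
  (the unweighted count, eq. (1.8));
* named facts: `Literature.NumberTheory.Sieve.tendsto_singularProductPartial` (Lemma 1.3: `∏_p β_p` converges),
  `Literature.NumberTheory.Sieve.generalizedHardyLittlewood_count_of_vonMangoldt` (Conj. 1.2 ⇒ Conj. 1.4, sketched after
  (1.8)), and the theorem of Green–Tao / Green–Tao–Ziegler
  `Literature.NumberTheory.Sieve.GreenTaoZiegler2012_finiteComplexity` (Main Theorem of Green–Tao 2010 made unconditional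
  by Green–Tao 2012 (`MN(s)`, bib `GreenTao2012Mobius`) and Green–Tao–Ziegler 2012 (`GI(s)`)):
  Conjecture 1.2 holds for systems of finite complexity.

Mathlib (pinned) has `ArithmeticFunction.vonMangoldt`, `Nat.primesLE`, `Nat.totient`, `Convex`,
`MeasureTheory.volume` on `Fin d → ℝ`, `AffineMap`, `Asymptotics`; it has no affine-linear
systems / local factors / Hardy–Littlewood material (searched `HardyLittlewood`,
`vonMangoldt.*local`, `singular.*product`, `affine.*linear.*form`).

## Design choices

* Coefficient representation. `AffLinForm d` is the pair (coefficient vector, constant): the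
  size `‖Ψ‖_N`, the reductions mod `q`, and the real extension are all read off the
  coefficients, exactly as in Green–Tao (1.1); `toAffineMap`/`toAffineMap_apply` identify it with
  Mathlib's bundled affine maps `ℤ^d →ᵃ[ℤ] ℤ` (every such map has this form).
* Index types are `Fin d`, `Fin t` so that the conjectures are universe-free `Prop`s (as
  `BatemanHornConjecture`); `1 ≤ d`, `1 ≤ t` as in the source ("Let `N, d, t, L` be positive
  integers"); for `t = 0` the statement would be the (true) lattice-point count (1.3), which we do
  not include.
* `o_{t,d,L}(N^d)` (Green–Tao §3: a quantity bounded by `c_{t,d,L}(N) N^d` with `c → 0`) is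
  rendered as `∀ ε > 0, ∃ N₀, ∀ N ≥ N₀, ∀ Ψ (‖Ψ‖_N ≤ L), ∀ K, |error| ≤ ε N^d` — uniform in the
  system and the convex body, as the subscripts indicate.
* Convex bodies: `K ⊆ [-N, N]^d` convex (`Convex ℝ K`); no interior/closedness condition is
  imposed (Green–Tao's Appendix A arguments use only convexity and boundedness, and boundary
  effects are `O(N^{d-1})`); convex sets are null-measurable (`Convex.nullMeasurableSet`), so
  `volume` in `archFactor` is the Lebesgue measure of `K ∩ Ψ⁻¹(ℝ₊ᵗ)`.
* Lattice sums over `K ∩ ℤ^d` are finite sums over the box `[-N, N]^d ∩ ℤ^d`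
  (`Fintype.piFinset`) filtered by membership of the real point in `K`; since `K ⊆ [-N,N]^d`
  this is literally `∑_{n ∈ K ∩ ℤ^d}`.
* (D-SIEVE-1) `singularProduct Ψ = lim_{x→∞} ∏_{p ≤ x} β_p` is an ordered `limUnder`; the limit
  exists (indeed absolutely, `β_p = 1 + O(p⁻²)` for `p > C N`, Lemma 1.3), recorded as the named
  fact `tendsto_singularProductPartial`; it may vanish (local obstruction).
* Primality of an integer value `m` means `m ∈ P = {2, 3, 5, …}`: `m.toNat.Prime`
  (`Int.toNat` of a negative number is `0`, not prime).

## References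

* B. Green, T. Tao, *Linear equations in primes*, Ann. of Math. (2) 171 (2010), 1753–1850
  (arXiv:math/0606088): Def. 1.1, (1.1)–(1.8), Conj. 1.2, Lemma 1.3, Conj. 1.4, Def. 1.5,
  Main Theorem, Cor. 1.7.
* B. Green, T. Tao, *The Möbius function is strongly orthogonal to nilsequences*, Ann. of
  Math. (2) 175 (2012), 541–566, Thm. 1.1 (the conjecture `MN(s)` for all `s`).
* B. Green, T. Tao, T. Ziegler, *An inverse theorem for the Gowers `U^{s+1}[N]`-norm*, Ann. of
  Math. (2) 176 (2012), 1231–1372, Thm. 1.3 (the conjecture `GI(s)`, `s ≥ 3`) and the paragraph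
  following it (Hardy–Littlewood prime tuples asymptotic for all systems of finite complexity).
* G. H. Hardy, J. E. Littlewood, *Some problems of 'Partitio Numerorum' III*, Acta Math. 44
  (1923), 1–70 (the case `d = 1`, `ψᵢ(n) = n + bᵢ`).
-/

noncomputable section

open Filter Finset MeasureTheory
open scoped Topology ArithmeticFunction.vonMangoldt

namespace Literature.NumberTheory.Sieve

/-! ### Affine-linear forms and systems (Green–Tao 2010, Def. 1.1) -/

/-- An *affine-linear form* on `ℤ^d`: `ψ(n) = ∑ⱼ ψ̇(eⱼ) nⱼ + ψ(0)`, the sum of a linear form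
`ψ̇` (given by its values `coeff j = ψ̇(eⱼ)` on the standard basis) and a constant
`const = ψ(0)`. A system of `t` forms is a map `Fin t → AffLinForm d`.
[cite: GreenTao2010, Def. 1.1] -/
@[ext]
structure AffLinForm (d : ℕ) where
  /-- the coefficients `ψ̇(e₁), …, ψ̇(e_d)` of the linear part -/
  coeff : Fin d → ℤ
  /-- the constant term `ψ(0)` -/
  const : ℤ

namespace AffLinForm

variable {d : ℕ}

/-- The value `ψ(n) = ∑ⱼ ψ̇(eⱼ) nⱼ + ψ(0)` at a lattice point `n ∈ ℤ^d`.
[cite: GreenTao2010, Def. 1.1] -/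
def eval (ψ : AffLinForm d) (n : Fin d → ℤ) : ℤ :=
  ∑ j, ψ.coeff j * n j + ψ.const

/-- Forms are functions on `ℤ^d` via `eval`. [folklore] -/
instance : CoeFun (AffLinForm d) (fun _ => (Fin d → ℤ) → ℤ) := ⟨eval⟩

/-- The linear part `ψ̇(n) = ∑ⱼ ψ̇(eⱼ) nⱼ`. [cite: GreenTao2010, Def. 1.1] -/
def linearPart (ψ : AffLinForm d) (n : Fin d → ℤ) : ℤ :=
  ∑ j, ψ.coeff j * n j

/-- The extension of `ψ` to an affine-linear map `ℝ^d → ℝ` "in the obvious manner".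
[cite: GreenTao2010, Def. 1.1] -/
def realEval (ψ : AffLinForm d) (x : Fin d → ℝ) : ℝ :=
  ∑ j, (ψ.coeff j : ℝ) * x j + ψ.const

/-- Bridge to Mathlib: `ψ` as a bundled affine map `ℤ^d →ᵃ[ℤ] ℤ` with linear part
`∑ⱼ ψ̇(eⱼ) · projⱼ`. [cite: GreenTao2010, Def. 1.1] -/
def toAffineMap (ψ : AffLinForm d) : (Fin d → ℤ) →ᵃ[ℤ] ℤ where
  toFun := ψ.eval
  linear := ∑ j, ψ.coeff j • LinearMap.proj j
  map_vadd' p v := by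
    simp only [eval, vadd_eq_add, Pi.add_apply, LinearMap.coe_sum, Finset.sum_apply,
      LinearMap.smul_apply, LinearMap.coe_proj, Function.eval, smul_eq_mul]
    rw [← add_assoc, ← Finset.sum_add_distrib]
    congr 1
    exact Finset.sum_congr rfl fun j _ => by ring

/-- The function coercion is `eval`. [folklore] -/
@[simp] theorem coe_apply (ψ : AffLinForm d) (n : Fin d → ℤ) : ψ n = ψ.eval n := rfl

/-- `toAffineMap` computes `eval`. [folklore] -/
@[simp] theorem toAffineMap_apply (ψ : AffLinForm d) (n : Fin d → ℤ) :
    ψ.toAffineMap n = ψ.eval n := rfl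

/-- The constant term is the value at `0`: `ψ(0) = const`. [cite: GreenTao2010, Def. 1.1] -/
@[simp] theorem eval_zero (ψ : AffLinForm d) : ψ.eval 0 = ψ.const := by
  simp [eval]

/-- `ψ = ψ̇ + ψ(0)`. [cite: GreenTao2010, Def. 1.1] -/
theorem eval_eq_linearPart_add_const (ψ : AffLinForm d) (n : Fin d → ℤ) :
    ψ.eval n = ψ.linearPart n + ψ.const := rfl

/-- The coefficient `ψ̇(eⱼ)` is recovered by evaluating the linear part on the basis vector
`eⱼ = Pi.single j 1`. [cite: GreenTao2010, (1.1)] -/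
@[simp] theorem linearPart_single (ψ : AffLinForm d) (j : Fin d) :
    ψ.linearPart (Pi.single j 1) = ψ.coeff j := by
  simp [linearPart, Pi.single_apply]

/-- The real extension agrees with `eval` on lattice points. [cite: GreenTao2010, Def. 1.1] -/
@[simp] theorem realEval_intCast (ψ : AffLinForm d) (n : Fin d → ℤ) :
    ψ.realEval (fun j => (n j : ℝ)) = (ψ.eval n : ℝ) := by
  simp [realEval, eval]

end AffLinForm

variable {d t : ℕ}

/-- Green–Tao's standing non-degeneracy hypotheses on a system `Ψ = (ψ₁, …, ψ_t)` (Def. 1.1,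
"to avoid trivial degeneracies"): every form is non-constant (`ψ̇ᵢ ≠ 0`), and no two distinct
forms are rational multiples of each other (`a ψᵢ = b ψⱼ` as functions on `ℤ^d` forces
`a = b = 0`). [cite: GreenTao2010, Def. 1.1] -/
def IsNondegenerateSystem (Ψ : Fin t → AffLinForm d) : Prop :=
  (∀ i, (Ψ i).coeff ≠ 0) ∧
    ∀ i j, i ≠ j → ∀ a b : ℤ, (∀ n, a * (Ψ i).eval n = b * (Ψ j).eval n) → a = 0 ∧ b = 0

/-- *Finite complexity* (Green–Tao 2010, Def. 1.5, in the equivalent form used in Cor. 1.7 and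
the discussion after it): the complexity of `Ψ` is finite iff no form lies in the affine-linear
span of a single other form, i.e. iff no two linear parts `ψ̇ᵢ, ψ̇ⱼ` (`i ≠ j`) are parallel
(rational multiples of each other); the "infinite complexity" case is the binary one "in which
two or more of the forms are affinely related". [cite: GreenTao2010, Def. 1.5 and Cor. 1.7] -/
def IsFiniteComplexitySystem (Ψ : Fin t → AffLinForm d) : Prop :=
  ∀ i j, i ≠ j → ∀ a b : ℤ, a • (Ψ i).coeff = b • (Ψ j).coeff → a = 0 ∧ b = 0

/-- The size of `Ψ` relative to the scale `N`:
`‖Ψ‖_N = ∑ᵢ ∑ⱼ |ψ̇ᵢ(eⱼ)| + ∑ᵢ |ψᵢ(0) / N|`. [cite: GreenTao2010, (1.1)] -/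
def affLinSize (Ψ : Fin t → AffLinForm d) (N : ℝ) : ℝ :=
  ∑ i, ∑ j, |((Ψ i).coeff j : ℝ)| + ∑ i, |((Ψ i).const : ℝ) / N|

/-! ### Weights: von Mangoldt on `ℤ`, local von Mangoldt functions, local factors -/

/-- The von Mangoldt function on `ℤ`: `Λ(n) = log p` if `n > 1` is a power of the prime `p`,
and `Λ(n) = 0` otherwise, in particular for all `n ≤ 0` (Mathlib's `Λ` on `ℕ` composed with
`Int.toNat`, which sends negative integers to `0`, and `Λ 0 = Λ 1 = 0`).
[cite: GreenTao2010, §1 (before (1.2))] -/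
def intVonMangoldt (n : ℤ) : ℝ :=
  Λ n.toNat

/-- The local von Mangoldt function `Λ_{ℤ/qℤ} : ℤ → ℝ`: the `q`-periodic function equal to
`q / φ(q)` on residues coprime to `q` and `0` otherwise (for a prime `p`: `p/(p-1)` off the zero
class, `0` on it). [cite: GreenTao2010, (1.5)] -/
def localVonMangoldt (q : ℕ) (b : ℤ) : ℝ :=
  if Int.gcd b q = 1 then (q : ℝ) / Nat.totient q else 0

/-- The local factor `β_q = 𝔼_{n ∈ (ℤ/qℤ)^d} ∏ᵢ Λ_{ℤ/qℤ}(ψᵢ(n))`, computed on the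
representatives `{0, …, q-1}^d` (the integrand is `q`-periodic in each coordinate). For a prime
`p`, `β_p = (p/(p-1))^t · ℙ_{n ∈ (ℤ/p)^d}(p ∤ ψ₁(n) ⋯ ψ_t(n))`. (Junk `0` for `q = 0`.)
[cite: GreenTao2010, (1.6)] -/
def localFactor (Ψ : Fin t → AffLinForm d) (q : ℕ) : ℝ :=
  ((q : ℝ) ^ d)⁻¹ *
    ∑ n ∈ Fintype.piFinset (fun _ : Fin d => range q),
      ∏ i, localVonMangoldt q ((Ψ i).eval fun j => (n j : ℤ))

/-- Ordered partial singular product `∏_{p ≤ x} β_p` (D-SIEVE-1). [cite: GreenTao2010, (1.7)] -/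
def singularProductPartial (Ψ : Fin t → AffLinForm d) (x : ℕ) : ℝ :=
  ∏ p ∈ Nat.primesLE x, localFactor Ψ p

/-- The singular product `∏_p β_p = lim_{x → ∞} ∏_{p ≤ x} β_p` of the system `Ψ`, as an
ordered limit (D-SIEVE-1). The limit exists — the product is even absolutely convergent since
`β_p = 1 + O_{t,d,L}(p⁻²)` for `p > C(t,d,L) N` (Lemma 1.3, `tendsto_singularProductPartial`) —
but "could vanish, thanks to the presence of the small primes" (local obstructions).
[cite: GreenTao2010, Lemma 1.3 and (1.7)] -/
def singularProduct (Ψ : Fin t → AffLinForm d) : ℝ :=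
  limUnder atTop (singularProductPartial Ψ)

/-- The archimedean factor `β_∞ = vol_d(K ∩ Ψ⁻¹((ℝ₊)ᵗ))`, the Lebesgue measure of the part of
`K` where all real-extended forms are positive (finite for bounded `K`; `ENNReal.toReal`).
[cite: GreenTao2010, (1.4)] -/
def archFactor (Ψ : Fin t → AffLinForm d) (K : Set (Fin d → ℝ)) : ℝ :=
  (volume (K ∩ {x | ∀ i, 0 < (Ψ i).realEval x})).toReal

/-! ### Prime-point sums and counts over a convex body -/

/-- The lattice points of the box `[-N, N]^d`. [cite: GreenTao2010, §1] -/
def latticeBox (d N : ℕ) : Finset (Fin d → ℤ) :=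
  Fintype.piFinset fun _ : Fin d => Icc (-(N : ℤ)) N

/-- The real point of a lattice point. [folklore] -/
def realPoint (n : Fin d → ℤ) : Fin d → ℝ := fun j => (n j : ℝ)

open Classical in
/-- The weighted prime-point sum `∑_{n ∈ K ∩ ℤ^d} ∏ᵢ Λ(ψᵢ(n))` for `K ⊆ [-N, N]^d`
(eq. (1.2)); the sum ranges over the lattice points of the box whose real point lies in `K`,
which for `K ⊆ [-N,N]^d` is exactly `K ∩ ℤ^d`. Points are counted with the multiplicity of `Ψ`
(GT, Remark after (1.2)). [cite: GreenTao2010, (1.2)] -/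
def vonMangoldtSum (Ψ : Fin t → AffLinForm d) (K : Set (Fin d → ℝ)) (N : ℕ) : ℝ :=
  ∑ n ∈ (latticeBox d N).filter (fun n => realPoint n ∈ K), ∏ i, intVonMangoldt ((Ψ i).eval n)

open Classical in
/-- The prime-point count `#{n ∈ K ∩ ℤ^d : ψ₁(n), …, ψ_t(n) ∈ P}` for `K ⊆ [-N, N]^d`, where
`P = {2, 3, 5, …}` (a value `m ∈ ℤ` is prime iff `m.toNat` is a prime natural number).
[cite: GreenTao2010, (1.8)] -/
def primePointCount (Ψ : Fin t → AffLinForm d) (K : Set (Fin d → ℝ)) (N : ℕ) : ℕ :=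
  #((latticeBox d N).filter fun n => realPoint n ∈ K ∧ ∀ i, ((Ψ i).eval n).toNat.Prime)

/-- The box `[-N, N]^d ⊆ ℝ^d`. [cite: GreenTao2010, §1] -/
def realBox (d : ℕ) (N : ℝ) : Set (Fin d → ℝ) :=
  Set.Icc (fun _ => -N) (fun _ => N)

/-! ### The conjectures -/

/-- **The generalised Hardy–Littlewood conjecture** (Green–Tao 2010, Conjecture 1.2; all
complexities). Let `d, t, L` be positive integers. Then, as `N → ∞`, uniformly over all systems
`Ψ = (ψ₁, …, ψ_t)` of affine-linear forms on `ℤ^d` (non-constant, pairwise not rational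
multiples of each other) of size `‖Ψ‖_N ≤ L` and all convex bodies `K ⊆ [-N, N]^d`,
`∑_{n ∈ K ∩ ℤ^d} ∏ᵢ Λ(ψᵢ(n)) = β_∞ ∏_p β_p + o_{t,d,L}(N^d)`,
i.e. for every `ε > 0` there is `N₀` with
`|∑_{n ∈ K ∩ ℤ^d} ∏ᵢ Λ(ψᵢ(n)) - β_∞ ∏_p β_p| ≤ ε N^d` for all `N ≥ N₀` and all such `Ψ`, `K`.
The finite-complexity case is a theorem (`GreenTaoZiegler2012_finiteComplexity`); the open
content is the infinite-complexity ("binary", `d = 1, t > 1`-type) case containing the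
Hardy–Littlewood prime `k`-tuples, twin prime and Goldbach asymptotics. Open conjecture, stated
as a `Prop`. [cite: GreenTao2010, Conj. 1.2] -/
def GeneralizedHardyLittlewood : Prop :=
  ∀ (d t L : ℕ), 1 ≤ d → 1 ≤ t → ∀ ε : ℝ, 0 < ε → ∃ N₀ : ℕ, ∀ N : ℕ, N₀ ≤ N →
    ∀ Ψ : Fin t → AffLinForm d, IsNondegenerateSystem Ψ → affLinSize Ψ N ≤ L →
      ∀ K : Set (Fin d → ℝ), Convex ℝ K → K ⊆ realBox d N →
        |vonMangoldtSum Ψ K N - archFactor Ψ K * singularProduct Ψ| ≤ ε * (N : ℝ) ^ d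

/-- **The generalised Hardy–Littlewood conjecture, counting form** (Green–Tao 2010,
Conjecture 1.4, eq. (1.8)). With `d, t, L, Ψ, K` as in `GeneralizedHardyLittlewood`,
`#{n ∈ K ∩ ℤ^d : ψ₁(n), …, ψ_t(n) prime}`
`= (1 + o_{t,d,L}(1)) (β_∞ / logᵗ N) ∏_p β_p + o_{t,d,L}(N^d / logᵗ N)`,
rendered (using `β_∞, ∏_p β_p ≥ 0`) as: for every `ε > 0`, eventually in `N` and uniformly in
`Ψ`, `K`,
`|count - β_∞ ∏_p β_p / logᵗ N| ≤ ε (β_∞ ∏_p β_p + N^d) / logᵗ N`.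
Green–Tao sketch its derivation from Conjecture 1.2
(`generalizedHardyLittlewood_count_of_vonMangoldt`).
Open conjecture, stated as a `Prop`. [cite: GreenTao2010, Conj. 1.4] -/
@[conjecture] def GeneralizedHardyLittlewoodCount : Prop :=
  ∀ (d t L : ℕ), 1 ≤ d → 1 ≤ t → ∀ ε : ℝ, 0 < ε → ∃ N₀ : ℕ, ∀ N : ℕ, N₀ ≤ N →
    ∀ Ψ : Fin t → AffLinForm d, IsNondegenerateSystem Ψ → affLinSize Ψ N ≤ L →
      ∀ K : Set (Fin d → ℝ), Convex ℝ K → K ⊆ realBox d N →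
        |(primePointCount Ψ K N : ℝ) -
            archFactor Ψ K * singularProduct Ψ / Real.log N ^ t| ≤
          ε * (archFactor Ψ K * singularProduct Ψ + (N : ℝ) ^ d) / Real.log N ^ t

/-! ### Named facts from Green–Tao 2010 and Green–Tao–Ziegler 2012 -/

/-- (Green–Tao 2010, Lemma 1.3 and the sentence following its proof: "In particular we see that
the singular series `∏_p β_p` is always convergent (though it could vanish …)".) For a system
satisfying the standing hypotheses, the ordered partial products `∏_{p ≤ x} β_p` converge (to
`singularProduct Ψ`, by definition of `limUnder`). [cite: GreenTao2010, Lemma 1.3] -/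
def tendsto_singularProductPartial : Prop :=
  ∀ (d t : ℕ) (Ψ : Fin t → AffLinForm d), IsNondegenerateSystem Ψ →
    Tendsto (singularProductPartial Ψ) atTop (𝓝 (singularProduct Ψ))

/-- (Green–Tao 2010, "Sketch proof of Conjecture 1.4 assuming Conjecture 1.2", after (1.8).)
The von Mangoldt-weighted conjecture implies the counting form.
[cite: GreenTao2010, Conj. 1.4 (sketch proof)] -/
def generalizedHardyLittlewood_count_of_vonMangoldt : Prop :=
  GeneralizedHardyLittlewood → GeneralizedHardyLittlewoodCount

/-- **Green–Tao / Green–Tao–Ziegler theorem** (Green–Tao 2010, Main Theorem: Conjecture 1.2 holds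
for systems of complexity `≤ s` assuming `GI(s)` and `MN(s)`; `MN(s)` is Green–Tao 2012,
Thm. 1.1, and `GI(s)` is Green–Tao–Ziegler 2012, Thm. 1.3, whose introduction records the
resulting unconditional "Hardy–Littlewood prime tuples conjecture for any linear system of
finite complexity"). The asymptotic of `GeneralizedHardyLittlewood` holds when restricted to
systems of finite complexity (`IsFiniteComplexitySystem`: no two linear parts parallel).
[cite: GreenTaoZiegler2012, Thm. 1.3 and the following paragraph]
[cite: GreenTao2010, Main Theorem and Cor. 1.7] -/
def GreenTaoZiegler2012_finiteComplexity : Prop :=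
  ∀ (d t L : ℕ), 1 ≤ d → 1 ≤ t → ∀ ε : ℝ, 0 < ε → ∃ N₀ : ℕ, ∀ N : ℕ, N₀ ≤ N →
    ∀ Ψ : Fin t → AffLinForm d, IsNondegenerateSystem Ψ → IsFiniteComplexitySystem Ψ →
      affLinSize Ψ N ≤ L →
      ∀ K : Set (Fin d → ℝ), Convex ℝ K → K ⊆ realBox d N →
        |vonMangoldtSum Ψ K N - archFactor Ψ K * singularProduct Ψ| ≤ ε * (N : ℝ) ^ d

/-- `GeneralizedHardyLittlewood` contains the finite-complexity theorem as a special case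
(drop the complexity hypothesis). [folklore] -/
theorem GeneralizedHardyLittlewood.finiteComplexity (h : GeneralizedHardyLittlewood) :
    GreenTaoZiegler2012_finiteComplexity := by
  intro d t L hd ht ε hε
  obtain ⟨N₀, hN₀⟩ := h d t L hd ht ε hε
  exact ⟨N₀, fun N hN Ψ hΨ _ hL K hK hKN => hN₀ N hN Ψ hΨ hL K hK hKN⟩

/-! ### API and examples -/

/-- A finite-complexity system with non-constant forms satisfies the standing hypotheses: if no
two linear parts are parallel then no two forms are rational multiples of each other.
[cite: GreenTao2010, Def. 1.5] -/
theorem IsFiniteComplexitySystem.isNondegenerateSystem {Ψ : Fin t → AffLinForm d}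
    (h : IsFiniteComplexitySystem Ψ) (h0 : ∀ i, (Ψ i).coeff ≠ 0) : IsNondegenerateSystem Ψ := by
  refine ⟨h0, fun i j hij a b hab => h i j hij a b ?_⟩
  -- compare linear parts: evaluate `a ψᵢ = b ψⱼ` at `eⱼ'` and at `0`
  have h0' := hab 0
  simp only [AffLinForm.eval_zero] at h0'
  funext k
  have hk := hab (Pi.single k 1)
  simp only [AffLinForm.eval_eq_linearPart_add_const, AffLinForm.linearPart_single, mul_add]
    at hk
  simp only [Pi.smul_apply, smul_eq_mul]
  linarith

/-- The twin-prime system `n ↦ (n, n + 2)` (`d = 1`, `t = 2`; Green–Tao 2010, Example 1).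
[cite: GreenTao2010, Example 1] -/
def twinPrimeSystem : Fin 2 → AffLinForm 1 :=
  ![⟨![1], 0⟩, ⟨![1], 2⟩]

/-- The twin-prime system satisfies the standing hypotheses (both forms are `n + c`, and
`a n = b (n + 2)` for all `n` forces `a = b = 0`), but has infinite complexity (its two linear
parts coincide). [cite: GreenTao2010, Example 1 and Examples after Def. 1.5] -/
theorem isNondegenerateSystem_twinPrimeSystem :
    IsNondegenerateSystem twinPrimeSystem ∧ ¬ IsFiniteComplexitySystem twinPrimeSystem := by
  constructor
  · refine ⟨fun i => ?_, fun i j hij a b hab => ?_⟩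
    · fin_cases i <;> simp [twinPrimeSystem]
    · have h0 := hab 0
      have h1 := hab 1
      fin_cases i <;> fin_cases j <;>
        simp_all [twinPrimeSystem, AffLinForm.eval]
  · intro h
    have := h 0 1 (by decide) 1 1 (by simp [twinPrimeSystem])
    omega

/-- Sums over `{0,…}^1 = piFinset` in dimension `d = 1` are sums over the single coordinate.
[folklore] -/
theorem sum_piFinset_fin_one {M : Type*} [AddCommMonoid M] (s : Finset ℕ)
    (f : (Fin 1 → ℕ) → M) :
    ∑ n ∈ Fintype.piFinset (fun _ : Fin 1 => s), f n = ∑ m ∈ s, f (fun _ => m) := by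
  refine Finset.sum_nbij' (fun n => n 0) (fun m _ => m) (fun n hn => ?_) (fun m hm => ?_)
    (fun n _ => ?_) (fun m _ => rfl) (fun n _ => ?_)
  · exact Fintype.mem_piFinset.mp (Finset.mem_coe.mp hn) 0
  · exact Finset.mem_coe.mpr (Fintype.mem_piFinset.mpr fun _ => Finset.mem_coe.mp hm)
  · funext i; simp [Fin.fin_one_eq_zero i]
  · congr 1; funext i; simp [Fin.fin_one_eq_zero i]

/-- Sanity check of the normalisation of `localFactor`: for the twin-prime system,
`β₂ = ½ · (Λ_{ℤ/2}(0)Λ_{ℤ/2}(2) + Λ_{ℤ/2}(1)Λ_{ℤ/2}(3)) = ½ · (0 + 2·2) = 2`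
(`= (2/1)² · ℙ(n odd)`). [cite: GreenTao2010, Example 1] -/
theorem localFactor_twinPrimeSystem_two : localFactor twinPrimeSystem 2 = 2 := by
  rw [localFactor, sum_piFinset_fin_one]
  simp [localVonMangoldt, twinPrimeSystem, AffLinForm.eval, Finset.sum_range_succ,
    Fin.prod_univ_two]

end Literature.NumberTheory.Sieve
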